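import Literature.AlgebraicGeometry.HodgeTheory.CyclicCoverPencilSlice
import Literature.AlgebraicGeometry.HodgeTheory.CyclicCoverPencilModelIsotopyProps
import Literature.AlgebraicGeometry.HodgeTheory.CyclicCoverPencilModelIsotopyRadius
import Literature.AlgebraicGeometry.HodgeTheory.CyclicCoverPencilModelIsotopyFlow
import Literature.AlgebraicGeometry.HodgeTheory.CyclicCoverPencilModelIsotopyContinuity
import Literature.AlgebraicGeometry.HodgeTheory.CyclicCoverPencilModelIsotopyGoodSet
import Literature.Geometry.Manifold.ShellInterpolatedIsotopyPunctured
import HarnessLib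

/-!
# The geometric monodromy map of the nodal pencil on the pencil slice (shell interpolation of the model
# isotopy and the fold isotopy)

Family `hodge`, layer `Literature/AlgebraicGeometry/HodgeTheory`; step A3c of the programme discharging
`carlsonToledo1999_nodalMeridianLocalMonodromyBound` (crux K1 of
`Summits/HodgeConjecture/HodgeConjecture/Theses/CyclicUnitaryPowers.lean`): the classical construction of the geometric
monodromy of the pencil `x₃^p = f₁ + c·x₂^p` around its nodal member (Arnold–Gusein-Zade–Varchenko II §1.1, §2.1; Milnor §9
Lemma 9.4), assembled on the pencil slice `S = pencilSlice p ⊆ 𝒴°(ℂ)` from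

* the MODEL isotopy `J(θ, x) = Φ⁻¹(b'₀, Θ⁻¹ R_θ Θ y(x))` (`chartModelIsotopy`; its properties at the good points of the slice —
  `CyclicCoverPencilModelIsotopyProps/Radius/Flow/Continuity/GoodSet`), read as a self-map of `S` through `restrictIf`;
* a FOLD isotopy `g` of `𝒴°(ℂ)` (the output of `exists_pencil_foldIsotopy_invariant`, taken here as data with its seven
  properties), which preserves the slice;
* the radius function `cutRadius` (equal to the saturated Morse radius `F` over the disc `|c| ≤ ρW/4`) and the continuous
  cut-off `λ(t) = σ((t − t₁)/(t₂ − t₁))`,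

by the punctured shell interpolation `ShellInterpolatedIsotopyPunctured` (radii `s₁² ≤ t₁ < t₂ ≤ T' < T`, disc `|c| < δ₀`,
`δ₀ ≤ ρW/4`). Main result `exists_pencil_monodromyMap`: self-maps `h, k, H` of `ℝ × S` with — at the points of the slice over
the punctured disc `0 < |c| < δ₀` — `h` continuous, `h(0, ·) = id`, `c(h(u, x)) = e^{2πiu} c(x)` (so `h(u, ·)` carries the
member `X_c` to `X_{e^{2πiu}c}`), `F` preserved below `T` and kept above `T'`, `k(u, ·)` a two-sided inverse of `h(u, ·)`,
**`h(1, ·) = id` where `F ≥ t₂`**, and the homotopy `H(s, ·)` through self-maps of each fibre-ball `{c = const, F < T}` from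
**`H(0, ·) = J(2π, ·)` (the model monodromy in the Morse chart)** to `H(1, ·) = h(1, ·)` (where `F ≤ T'`).

Everything is proved; no definitions, no named facts.

## References

* [ArnoldGuseinzadeVarchenko2012] V. I. Arnold, S. M. Gusein-Zade, A. N. Varchenko, Singularities of Differentiable Maps II (2012),
  Part I §1.1 (held text p0013, p0025), §2.1.
* [Milnor1968] J. Milnor, Singular Points of Complex Hypersurfaces, §9 Lemma 9.4.
* [CarlsonToledo1999] J. A. Carlson, D. Toledo, Duke Math. J. 97 (1999), §6 (kdoublept).
-/

noncomputable section

open CategoryTheory AlgebraicGeometry MvPolynomial TopologicalSpace Set Topology Filter Complex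
open scoped Manifold ContDiff Real
open Literature.AlgebraicGeometry.Motives Literature.AlgebraicGeometry.Motives.UniversalHypersurface
open Literature.AlgebraicGeometry.HodgeTheory.UniversalHypersurface Literature.Geometry.ComplexAnalytic Literature.Geometry.Manifold

namespace Literature.AlgebraicGeometry.HodgeTheory

section MonodromyMap

variable {p : ℕ} (hp : 3 ≤ p)
  (Φ : OpenPartialHomeomorph (ComplexPoints (regularTotal ℂ 2 p)) (({m : DegIndex 2 p // m ≠ regPowIndex 2 p 2} ⊕ Fin (2 + 1)) → ℂ))
  (hΦ : ⇑Φ = regChartFun 2 p 2) (hΦs : Φ.source = regChartDom 2 p 2) (hΦt : Φ.target = regChartFun 2 p 2 '' regChartDom 2 p 2)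
  (Θ : OpenPartialHomeomorph (Fin (1 + 2) → ℂ) (Fin (1 + 2) → ℂ)) {r R''' R'' : ℝ}
  (hr : {z : Fin (1 + 2) → ℂ | ∑ i, ‖z i‖ ^ 2 ≤ r ^ 2} ⊆ Θ.target)
  (hΘφ : ∀ x ∈ Θ.source, ∑ i, (Θ x) i ^ PhamBrieskorn.cyclicNodeExponents p i = x 2 ^ p - (x 0 * x 1 + x 0 ^ p + x 1 ^ p))
  {ρW : ℝ} (hρW : 0 < ρW)
  (hns : ∀ c : ℂ, c ≠ 0 → ‖c‖ < ρW → SmoothHypersurface.IsNonsingularForm ℂ (formOfCoeffs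
    (coeffsOf 2 p (cyclicCoverForm p (X 2 ^ (p - 2) * (X 0 * X 1) + X 0 ^ p + X 1 ^ p)) - Pi.single (regPowIndex 2 p 2) c)))
  (hR : R''' < R'') {T : ℝ} (hTR : T ≤ R''') (hTr : T ≤ r ^ 2)
include hp hΦ hΦs hΦt hr hΘφ hρW hns hR hTR hTr

/-! ### The model isotopy at the good points of the slice -/

omit hp hΦ hΦs hΦt hr hΘφ hρW hns hR hTR hTr in
/-- `R'' ≥ 0` (indeed `R'' > R''' ≥ T > 0`). [cite: ArnoldGuseinzadeVarchenko2012, Part I §2.1] -/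
theorem monodromyMap_R''_nonneg (hR : R''' < R'') (hT0 : 0 < T) (hTR : T ≤ R''') : 0 ≤ R'' := by linarith

omit hρW in
/-- **The data of a good point**: `x ∈ S`, `F(x) < T`, `0 < |c(x)| < ρW` ⇒ `x ∈ Φ.source`, `y(x) ∈ Θ.source`, `Σ|Θ y(x)|² < r²`,
`Σ|Θ y(x)|² ≤ R'''`, all rotated coordinate vectors in `Φ.target`. [cite: Milnor1968, §9 Lemma 9.4] -/
theorem monodromyMap_good {x : ComplexPoints (regularTotal ℂ 2 p)} (hxS : x ∈ pencilSlice p)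
    (hF : satRadius p Θ R''' R'' x < T) (hc0 : pencilCoord p x ≠ 0) (hcρ : ‖pencilCoord p x‖ < ρW) :
    x ∈ Φ.source ∧ (fun j => regChartFun 2 p 2 x (Sum.inr j)) ∈ Θ.source ∧
      ∑ k, ‖Θ (fun j => regChartFun 2 p 2 x (Sum.inr j)) k‖ ^ 2 < r ^ 2 ∧
      ∑ k, ‖Θ (fun j => regChartFun 2 p 2 x (Sum.inr j)) k‖ ^ 2 ≤ R''' ∧
      (∀ θ : ℝ, (Sum.elim (fun m => Φ x (Sum.inl m))
        (Θ.symm (fun k => Complex.exp (((θ / PhamBrieskorn.cyclicNodeExponents p k : ℝ) : ℂ) * I) *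
          Θ (fun j => Φ x (Sum.inr j)) k)) :
            ({m : DegIndex 2 p // m ≠ regPowIndex 2 p 2} ⊕ Fin (2 + 1)) → ℂ) ∈ Φ.target) := by
  obtain ⟨hx, hy, hyr, hθ⟩ := mem_goodSet_of_satRadius_lt hp Φ hΦ hΦs hΦt Θ hr hΘφ hns hR hTR hTr hxS hF hc0 hcρ
  obtain ⟨-, -, hSig⟩ := mem_of_satRadius_lt p Θ R''' R'' hR (lt_of_lt_of_le hF hTR)
  rw [hΦ] at hy hyr
  exact ⟨hx, hy, hyr, by rw [hSig]; exact (lt_of_lt_of_le hF hTR).le, hθ⟩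

omit hρW in
/-- **At a good point the model isotopy stays in the slice, with `c ↦ e^{iθ}c` and `F` preserved.**
[cite: Milnor1968, §9 Lemma 9.4] [cite: ArnoldGuseinzadeVarchenko2012, Part I §2.1] -/
theorem monodromyMap_model_spec {x : ComplexPoints (regularTotal ℂ 2 p)} (hxS : x ∈ pencilSlice p)
    (hF : satRadius p Θ R''' R'' x < T) (hc0 : pencilCoord p x ≠ 0) (hcρ : ‖pencilCoord p x‖ < ρW) (θ : ℝ) :
    chartModelIsotopy (PhamBrieskorn.cyclicNodeExponents p) Φ Θ θ x ∈ pencilSlice p ∧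
      pencilCoord p (chartModelIsotopy (PhamBrieskorn.cyclicNodeExponents p) Φ Θ θ x) = Complex.exp ((θ : ℂ) * I) * pencilCoord p x ∧
      satRadius p Θ R''' R'' (chartModelIsotopy (PhamBrieskorn.cyclicNodeExponents p) Φ Θ θ x) = satRadius p Θ R''' R'' x := by
  obtain ⟨hx, hy, hyr, hyR, -⟩ := monodromyMap_good hp Φ hΦ hΦs hΦt Θ hr hΘφ hns hR hTR hTr hxS hF hc0 hcρ
  exact ⟨fun m => regCoeff_chartModelIsotopy hp Φ hΦ hΦs hΦt Θ hr hΘφ hns hx hxS hy hyr hc0 hcρ θ m,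
    pencilCoord_chartModelIsotopy hp Φ hΦ hΦs hΦt Θ hr hΘφ hns hx hxS hy hyr hc0 hcρ θ,
    satRadius_chartModelIsotopy hp Φ hΦ hΦs hΦt Θ hr hΘφ hns hR hx hxS hy hyr hyR hc0 hcρ θ⟩

omit hρW in
/-- **On the slice, as a self-map**: at a good point `restrictIf S (J θ) x = J(θ, x)`. [cite: Milnor1968, §9 Lemma 9.4] -/
theorem monodromyMap_model_coe {x : pencilSlice p}
    (hF : satRadius p Θ R''' R'' x.1 < T) (hc0 : pencilCoord p x.1 ≠ 0) (hcρ : ‖pencilCoord p x.1‖ < ρW) (θ : ℝ) :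
    (restrictIf (pencilSlice p) (chartModelIsotopy (PhamBrieskorn.cyclicNodeExponents p) Φ Θ θ) x :
        ComplexPoints (regularTotal ℂ 2 p)) = chartModelIsotopy (PhamBrieskorn.cyclicNodeExponents p) Φ Θ θ x.1 :=
  restrictIf_coe _ _ (monodromyMap_model_spec hp Φ hΦ hΦs hΦt Θ hr hΘφ hns hR hTR hTr x.2 hF hc0 hcρ θ).1

omit hp hΦ hΦs hΦt hr hΘφ hns hR hTR hTr in
/-- **Points of the ball `{cutRadius < T}` over the punctured plane are good.** [cite: ArnoldGuseinzadeVarchenko2012, Part I §1.1] -/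
theorem monodromyMap_good_of_cutRadius_lt {x : ComplexPoints (regularTotal ℂ 2 p)}
    (hρ : cutRadius p Θ R''' R'' T ρW x < T) :
    satRadius p Θ R''' R'' x < T ∧ ‖pencilCoord p x‖ < ρW :=
  ⟨satRadius_lt_of_cutRadius_lt p Θ R''' R'' T ρW hρ,
    lt_of_lt_of_le (norm_lt_of_cutRadius_lt p Θ R''' R'' T ρW hρW hρ) (by linarith)⟩

omit hp hΦ hΦs hΦt hr hΘφ hρW hns hR hTR hTr in
/-- `cutRadius` only depends on `F` and `|c|`. [cite: ArnoldGuseinzadeVarchenko2012, Part I §1.1] -/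
theorem cutRadius_congr {x x' : ComplexPoints (regularTotal ℂ 2 p)}
    (hF : satRadius p Θ R''' R'' x' = satRadius p Θ R''' R'' x) (hc : ‖pencilCoord p x'‖ = ‖pencilCoord p x‖) :
    cutRadius p Θ R''' R'' T ρW x' = cutRadius p Θ R''' R'' T ρW x := by
  simp only [cutRadius, hF, hc]

/-- **Hypothesis `hI` of the shell interpolation** for `J` read on the slice with `ρ = cutRadius`, `p = c`.
[cite: ArnoldGuseinzadeVarchenko2012, Part I §1.1] [cite: Milnor1968, §9 Lemma 9.4] -/
theorem monodromyMap_hI (θ : ℝ) (x : pencilSlice p) (hρ : cutRadius p Θ R''' R'' T ρW x.1 < T) (hc0 : pencilCoord p x.1 ≠ 0) :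
    cutRadius p Θ R''' R'' T ρW
        (restrictIf (pencilSlice p) (chartModelIsotopy (PhamBrieskorn.cyclicNodeExponents p) Φ Θ θ) x).1 =
        cutRadius p Θ R''' R'' T ρW x.1 ∧
      pencilCoord p (restrictIf (pencilSlice p) (chartModelIsotopy (PhamBrieskorn.cyclicNodeExponents p) Φ Θ θ) x).1 =
        Complex.exp ((θ : ℂ) * I) * pencilCoord p x.1 := by
  obtain ⟨hF, hcρ⟩ := monodromyMap_good_of_cutRadius_lt Θ hρW hρ
  obtain ⟨-, hc, hFJ⟩ := monodromyMap_model_spec hp Φ hΦ hΦs hΦt Θ hr hΘφ hns hR hTR hTr x.2 hF hc0 hcρ θ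
  rw [monodromyMap_model_coe hp Φ hΦ hΦs hΦt Θ hr hΘφ hns hR hTR hTr hF hc0 hcρ θ]
  refine ⟨cutRadius_congr Θ hFJ ?_, hc⟩
  rw [hc, norm_mul, Complex.norm_exp_ofReal_mul_I, one_mul]

/-- **Hypothesis `hI0`**: `J(0, ·) = id` on the ball over the punctured plane. [cite: Milnor1968, §9 Lemma 9.4] -/
theorem monodromyMap_hI0 (x : pencilSlice p) (hρ : cutRadius p Θ R''' R'' T ρW x.1 < T) (hc0 : pencilCoord p x.1 ≠ 0) :
    restrictIf (pencilSlice p) (chartModelIsotopy (PhamBrieskorn.cyclicNodeExponents p) Φ Θ 0) x = x := by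
  obtain ⟨hF, hcρ⟩ := monodromyMap_good_of_cutRadius_lt Θ hρW hρ
  obtain ⟨hx, hy, -⟩ := monodromyMap_good hp Φ hΦ hΦs hΦt Θ hr hΘφ hns hR hTR hTr x.2 hF hc0 hcρ
  refine restrictIf_of_apply_eq _ _ ?_
  rw [← hΦ] at hy
  exact chartModelIsotopy_zero_of_mem (PhamBrieskorn.cyclicNodeExponents p) Φ Θ hx hy

/-- **Hypothesis `hIadd`**: the flow law of `J` on the ball over the punctured plane. [cite: Milnor1968, §9 Lemma 9.4] -/
theorem monodromyMap_hIadd (θ θ' : ℝ) (x : pencilSlice p) (hρ : cutRadius p Θ R''' R'' T ρW x.1 < T)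
    (hc0 : pencilCoord p x.1 ≠ 0) :
    restrictIf (pencilSlice p) (chartModelIsotopy (PhamBrieskorn.cyclicNodeExponents p) Φ Θ (θ + θ')) x =
      restrictIf (pencilSlice p) (chartModelIsotopy (PhamBrieskorn.cyclicNodeExponents p) Φ Θ θ)
        (restrictIf (pencilSlice p) (chartModelIsotopy (PhamBrieskorn.cyclicNodeExponents p) Φ Θ θ') x) := by
  obtain ⟨hF, hcρ⟩ := monodromyMap_good_of_cutRadius_lt Θ hρW hρ
  obtain ⟨hx, hy, hyr, -, -⟩ := monodromyMap_good hp Φ hΦ hΦs hΦt Θ hr hΘφ hns hR hTR hTr x.2 hF hc0 hcρ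
  -- the intermediate point is good again
  obtain ⟨-, hc', hF'⟩ := monodromyMap_model_spec hp Φ hΦ hΦs hΦt Θ hr hΘφ hns hR hTR hTr x.2 hF hc0 hcρ θ'
  have hF'' : satRadius p Θ R''' R''
      (restrictIf (pencilSlice p) (chartModelIsotopy (PhamBrieskorn.cyclicNodeExponents p) Φ Θ θ') x).1 < T := by
    rw [monodromyMap_model_coe hp Φ hΦ hΦs hΦt Θ hr hΘφ hns hR hTR hTr hF hc0 hcρ θ', hF']; exact hF
  have hc0'' : pencilCoord p (restrictIf (pencilSlice p) (chartModelIsotopy (PhamBrieskorn.cyclicNodeExponents p) Φ Θ θ') x).1 ≠ 0 := by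
    rw [monodromyMap_model_coe hp Φ hΦ hΦs hΦt Θ hr hΘφ hns hR hTR hTr hF hc0 hcρ θ', hc']
    exact mul_ne_zero (Complex.exp_ne_zero _) hc0
  have hcρ'' : ‖pencilCoord p (restrictIf (pencilSlice p) (chartModelIsotopy (PhamBrieskorn.cyclicNodeExponents p) Φ Θ θ') x).1‖ < ρW := by
    rw [monodromyMap_model_coe hp Φ hΦ hΦs hΦt Θ hr hΘφ hns hR hTR hTr hF hc0 hcρ θ', hc', norm_mul,
      Complex.norm_exp_ofReal_mul_I, one_mul]; exact hcρ
  apply Subtype.ext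
  rw [monodromyMap_model_coe hp Φ hΦ hΦs hΦt Θ hr hΘφ hns hR hTR hTr hF hc0 hcρ,
    monodromyMap_model_coe hp Φ hΦ hΦs hΦt Θ hr hΘφ hns hR hTR hTr hF'' hc0'' hcρ'',
    monodromyMap_model_coe hp Φ hΦ hΦs hΦt Θ hr hΘφ hns hR hTR hTr hF hc0 hcρ]
  exact chartModelIsotopy_add hp Φ hΦ hΦs hΦt Θ hr hΘφ hns hx x.2 hy hyr hc0 hcρ θ θ'

/-- **Hypothesis `hIcont`**: `(θ, x) ↦ J(θ, x)` is continuous on `ℝ × ({cutRadius < T} ∩ {c ≠ 0})` (as a map of the slice).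
[cite: Milnor1968, §9 Lemma 9.4] -/
theorem monodromyMap_hIcont :
    ContinuousOn (fun q : ℝ × pencilSlice p =>
        restrictIf (pencilSlice p) (chartModelIsotopy (PhamBrieskorn.cyclicNodeExponents p) Φ Θ q.1) q.2)
      (univ ×ˢ {x : pencilSlice p | cutRadius p Θ R''' R'' T ρW x.1 < T ∧ pencilCoord p x.1 ≠ 0}) := by
  have key : ContinuousOn (fun q : ℝ × pencilSlice p =>
      chartModelIsotopy (PhamBrieskorn.cyclicNodeExponents p) Φ Θ q.1 q.2.1)
      (univ ×ˢ {x : pencilSlice p | cutRadius p Θ R''' R'' T ρW x.1 < T ∧ pencilCoord p x.1 ≠ 0}) := by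
    refine (continuousOn_chartModelIsotopy (PhamBrieskorn.cyclicNodeExponents p) Φ Θ hr).comp
      (continuous_fst.prodMk (continuous_subtype_val.comp continuous_snd)).continuousOn ?_
    rintro ⟨θ, x⟩ ⟨-, hρ, hc0⟩
    obtain ⟨hF, hcρ⟩ := monodromyMap_good_of_cutRadius_lt Θ hρW hρ
    obtain ⟨hx, hy, hyr, hθ⟩ := mem_goodSet_of_satRadius_lt hp Φ hΦ hΦs hΦt Θ hr hΘφ hns hR hTR hTr x.2 hF hc0 hcρ
    exact ⟨mem_univ _, hx, hy, hyr, hθ⟩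
  rw [Topology.IsInducing.subtypeVal.continuousOn_iff]
  refine key.congr ?_
  rintro ⟨θ, x⟩ ⟨-, hρ, hc0⟩
  obtain ⟨hF, hcρ⟩ := monodromyMap_good_of_cutRadius_lt Θ hρW hρ
  exact monodromyMap_model_coe hp Φ hΦ hΦs hΦt Θ hr hΘφ hns hR hTR hTr hF hc0 hcρ θ

/-! ### The fold isotopy on the slice -/

variable (hT0 : 0 < T) (g : ℝ × ComplexPoints (regularTotal ℂ 2 p) → ComplexPoints (regularTotal ℂ 2 p)) (hgc : Continuous g)
  (hg0 : ∀ q, g (0, q) = q) (hg2π : ∀ q, g (2 * π, q) = q) {s₀ s₁ r₂ : ℝ}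
  (hgO : ∀ θ, ∀ q ∈ invariantSet p Θ R''' R'' s₁, ‖pencilCoord p q‖ < ρW →
    g (θ, q) ∈ invariantSet p Θ R''' R'' s₁ ∧ pencilCoord p (g (θ, q)) = Complex.exp (θ * I) * pencilCoord p q)
  (hgadd : ∀ θ θ', ∀ q ∈ invariantSet p Θ R''' R'' s₁, ‖pencilCoord p q‖ < ρW → g (θ + θ', q) = g (θ, g (θ', q)))
  (hgS : ∀ θ q, q ∈ pencilSlice p → g (θ, q) ∈ pencilSlice p)
  (hgF : ∀ θ q, q ∈ pencilSlice p → s₀ ^ 2 < satRadius p Θ R''' R'' q → satRadius p Θ R''' R'' q < r₂ ^ 2 →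
    satRadius p Θ R''' R'' (g (θ, q)) = satRadius p Θ R''' R'' q)
  (hs₀₁ : s₀ ^ 2 < s₁ ^ 2) (hTr₂ : T ≤ r₂ ^ 2) {δ₀ : ℝ} (hδ₀ : δ₀ ≤ ρW / 4)
include hT0 hgc hg0 hg2π hgO hgadd hgS hgF hs₀₁ hTr₂ hδ₀

omit hp hΦ hΦs hΦt hr hΘφ hρW hns hR hTR hTr hT0 hgc hg0 hg2π hgO hgadd hgF hs₀₁ hTr₂ hδ₀ in
/-- **The fold isotopy as a self-map of the slice**: `restrictIf S (g(θ, ·)) q = g(θ, q)`. [cite: ArnoldGuseinzadeVarchenko2012, Part I §2.1] -/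
theorem monodromyMap_fold_coe (θ : ℝ) (q : pencilSlice p) :
    (restrictIf (pencilSlice p) (fun x => g (θ, x)) q : ComplexPoints (regularTotal ℂ 2 p)) = g (θ, q.1) :=
  restrictIf_coe _ _ (hgS θ q.1 q.2)

omit hp hΦ hΦs hΦt hr hΘφ hns hTr hgc hg0 hg2π hgO hgadd hgS hgF hs₀₁ hTr₂ in
/-- Over the disc `|c| < δ₀ ≤ ρW/4` the cut radius is `F`. [cite: ArnoldGuseinzadeVarchenko2012, Part I §1.1] -/
theorem monodromyMap_cutRadius_eq {q : ComplexPoints (regularTotal ℂ 2 p)} (hq : ‖pencilCoord p q‖ < δ₀) :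
    cutRadius p Θ R''' R'' T ρW q = satRadius p Θ R''' R'' q :=
  cutRadius_eq_of_norm_le p Θ R''' R'' T ρW hρW (by linarith)
    (satRadius_nonneg p Θ R''' R'' hR (monodromyMap_R''_nonneg hR hT0 hTR) q)

omit hp hΦ hΦs hΦt hr hΘφ hns hTr hgc hg0 hg2π hgadd hgF hs₀₁ hTr₂ in
/-- **Hypothesis `hgO`** of the shell interpolation for `g` on the slice (`s₀ := s₁²`, disc `|c| < δ₀`).
[cite: ArnoldGuseinzadeVarchenko2012, Part I §2.1] -/
theorem monodromyMap_hgO (θ : ℝ) (q : pencilSlice p) (hρ : s₁ ^ 2 < cutRadius p Θ R''' R'' T ρW q.1)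
    (hq : ‖pencilCoord p q.1‖ < δ₀) :
    s₁ ^ 2 < cutRadius p Θ R''' R'' T ρW (restrictIf (pencilSlice p) (fun x => g (θ, x)) q).1 ∧
      pencilCoord p (restrictIf (pencilSlice p) (fun x => g (θ, x)) q).1 = Complex.exp ((θ : ℂ) * I) * pencilCoord p q.1 := by
  rw [monodromyMap_cutRadius_eq Θ hρW hR hTR hT0 hδ₀ hq] at hρ
  have hqA : q.1 ∈ invariantSet p Θ R''' R'' s₁ := ⟨q.2, hρ⟩
  obtain ⟨hgA, hgc'⟩ := hgO θ q.1 hqA (by linarith)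
  rw [monodromyMap_fold_coe g hgS]
  exact ⟨lt_of_lt_of_le hgA.2 (satRadius_le_cutRadius p Θ R''' R'' T ρW _), hgc'⟩

omit hp hΦ hΦs hΦt hr hΘφ hns hTr hgc hg0 hg2π hgO hgF hs₀₁ hTr₂ in
/-- **Hypothesis `hgadd`** for `g` on the slice. [cite: ArnoldGuseinzadeVarchenko2012, Part I §2.1] -/
theorem monodromyMap_hgadd (θ θ' : ℝ) (q : pencilSlice p) (hρ : s₁ ^ 2 < cutRadius p Θ R''' R'' T ρW q.1)
    (hq : ‖pencilCoord p q.1‖ < δ₀) :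
    restrictIf (pencilSlice p) (fun x => g (θ + θ', x)) q =
      restrictIf (pencilSlice p) (fun x => g (θ, x)) (restrictIf (pencilSlice p) (fun x => g (θ', x)) q) := by
  rw [monodromyMap_cutRadius_eq Θ hρW hR hTR hT0 hδ₀ hq] at hρ
  apply Subtype.ext
  rw [monodromyMap_fold_coe g hgS, monodromyMap_fold_coe g hgS, monodromyMap_fold_coe g hgS]
  exact hgadd θ θ' q.1 ⟨q.2, hρ⟩ (by linarith)

omit hp hΦ hΦs hΦt hr hΘφ hns hTr hgc hg0 hg2π hgadd in
/-- **Hypothesis `hgρ`** for `g` on the slice: `cutRadius` is preserved on the controlled region.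
[cite: ArnoldGuseinzadeVarchenko2012, Part I §2.1] -/
theorem monodromyMap_hgρ (θ : ℝ) (q : pencilSlice p)
    (hρ : s₁ ^ 2 < cutRadius p Θ R''' R'' T ρW q.1)
    (hq : ‖pencilCoord p q.1‖ < δ₀) (hρT : cutRadius p Θ R''' R'' T ρW q.1 < T) :
    cutRadius p Θ R''' R'' T ρW (restrictIf (pencilSlice p) (fun x => g (θ, x)) q).1 = cutRadius p Θ R''' R'' T ρW q.1 := by
  rw [monodromyMap_cutRadius_eq Θ hρW hR hTR hT0 hδ₀ hq] at hρ hρT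
  have hqA : q.1 ∈ invariantSet p Θ R''' R'' s₁ := ⟨q.2, hρ⟩
  obtain ⟨-, hgc'⟩ := hgO θ q.1 hqA (by linarith)
  rw [monodromyMap_fold_coe g hgS]
  refine cutRadius_congr Θ (hgF θ q.1 q.2 (hs₀₁.trans hρ) (lt_of_lt_of_le hρT hTr₂)) ?_
  rw [hgc', norm_mul, Complex.norm_exp_ofReal_mul_I, one_mul]

omit hp hΦ hΦs hΦt hr hΘφ hρW hns hR hTR hTr hT0 hg0 hg2π hgO hgadd hgF hs₀₁ hTr₂ hδ₀ in
/-- `g` is continuous as a self-map of the slice. [cite: ArnoldGuseinzadeVarchenko2012, Part I §2.1] -/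
theorem monodromyMap_hgcont :
    Continuous fun q : ℝ × pencilSlice p => restrictIf (pencilSlice p) (fun x => g (q.1, x)) q.2 := by
  rw [Topology.IsInducing.subtypeVal.continuous_iff]
  have h : (Subtype.val ∘ fun q : ℝ × pencilSlice p => restrictIf (pencilSlice p) (fun x => g (q.1, x)) q.2) =
      fun q => g (q.1, q.2.1) := funext fun q => monodromyMap_fold_coe g hgS q.1 q.2
  rw [h]
  exact hgc.comp (continuous_fst.prodMk (continuous_subtype_val.comp continuous_snd))

/-! ### The monodromy map -/

/-- **The geometric monodromy map of the nodal pencil on the slice.** Radii `s₁² ≤ t₁ < t₂ ≤ T' < T` (`T ≤ min(R''', r², r₂²)`),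
disc `|c| < δ₀ ≤ ρW/4`. There are self-maps `h, k, H` of `ℝ × S` such that, at the points `x ∈ S` with `c(x) ≠ 0` (and
`|c(x)| < δ₀` where indicated): `h` is continuous on `ℝ × {c ≠ 0}`; `h(0, x) = x`; `c(h(u, x)) = e^{2πiu} c(x)`, `F(h(u, x)) = F(x)` if
`F(x) < T`, `F(h(u, x)) > T'` if `F(x) > T'`; `k(u, ·)` is a two-sided inverse of `h(u, ·)`; **`h(1, x) = x` if `F(x) ≥ t₂`**; and `H` is
continuous on `ℝ × {F < T, 0 < |c| < δ₀}` with `c(H(s, x)) = c(x)`, `F(H(s, x)) = F(x)`, **`H(0, x) = J(2π, x)`** (the model monodromy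
`Φ⁻¹(b'₀, Θ⁻¹R_{2π}Θ y(x))`) and `H(1, x) = h(1, x)` if `F(x) ≤ T'`. [cite: ArnoldGuseinzadeVarchenko2012, Part I §1.1 (held text p0013, p0025)]
[cite: Milnor1968, §9 Lemma 9.4] -/
theorem exists_pencil_monodromyMap (hΘ : ContDiffOn ℝ ∞ Θ Θ.source)
    (hR'' : {z : Fin (1 + 2) → ℂ | ∑ i, ‖z i‖ ^ 2 ≤ R''} ⊆ Θ.target)
    {t₁ t₂ T' : ℝ} (ht₁ : s₁ ^ 2 ≤ t₁) (ht₁₂ : t₁ < t₂) (ht₂ : t₂ ≤ T') (hT' : T' < T) :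
    ∃ h k H : ℝ × pencilSlice p → pencilSlice p,
      (Continuous fun ux : ℝ × {x : pencilSlice p // pencilCoord p x.1 ≠ 0} => h (ux.1, ux.2.1)) ∧
      (∀ x, pencilCoord p x.1 ≠ 0 → h (0, x) = x) ∧
      (∀ u x, pencilCoord p x.1 ≠ 0 → ‖pencilCoord p x.1‖ < δ₀ →
        pencilCoord p (h (u, x)).1 = Complex.exp (((2 * π * u : ℝ) : ℂ) * I) * pencilCoord p x.1 ∧
        (satRadius p Θ R''' R'' x.1 < T → satRadius p Θ R''' R'' (h (u, x)).1 = satRadius p Θ R''' R'' x.1) ∧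
        (T' < satRadius p Θ R''' R'' x.1 → T' < satRadius p Θ R''' R'' (h (u, x)).1) ∧
        k (u, h (u, x)) = x ∧ h (u, k (u, x)) = x) ∧
      (∀ x, pencilCoord p x.1 ≠ 0 → ‖pencilCoord p x.1‖ < δ₀ → t₂ ≤ satRadius p Θ R''' R'' x.1 → h (1, x) = x) ∧
      ContinuousOn H (univ ×ˢ {x : pencilSlice p |
        satRadius p Θ R''' R'' x.1 < T ∧ pencilCoord p x.1 ≠ 0 ∧ ‖pencilCoord p x.1‖ < δ₀}) ∧
      (∀ s x, pencilCoord p x.1 ≠ 0 → ‖pencilCoord p x.1‖ < δ₀ → satRadius p Θ R''' R'' x.1 < T →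
        pencilCoord p (H (s, x)).1 = pencilCoord p x.1 ∧
        satRadius p Θ R''' R'' (H (s, x)).1 = satRadius p Θ R''' R'' x.1 ∧
        (H (0, x)).1 = chartModelIsotopy (PhamBrieskorn.cyclicNodeExponents p) Φ Θ (2 * π) x.1 ∧
        (satRadius p Θ R''' R'' x.1 ≤ T' → H (1, x) = h (1, x))) := by
  -- the data of `ShellInterpolatedIsotopyPunctured` on `M = S`
  let ρ : pencilSlice p → ℝ := fun x => cutRadius p Θ R''' R'' T ρW x.1
  let pc : pencilSlice p → ℂ := fun x => pencilCoord p x.1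
  let J : ℝ × pencilSlice p → pencilSlice p := fun q =>
    restrictIf (pencilSlice p) (chartModelIsotopy (PhamBrieskorn.cyclicNodeExponents p) Φ Θ q.1) q.2
  let G : ℝ × pencilSlice p → pencilSlice p := fun q => restrictIf (pencilSlice p) (fun x => g (q.1, x)) q.2
  let lam : ℝ → ℝ := fun t => Real.smoothTransition ((t - t₁) / (t₂ - t₁))
  have hρc : Continuous ρ := (continuous_cutRadius p Θ R''' R'' T ρW (by omega) hΘ hR hR'').comp continuous_subtype_val
  have hlam : Continuous lam :=
    Real.smoothTransition.continuous.comp ((continuous_id.sub continuous_const).div_const _)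
  have hlam₀ : ∀ t, t ≤ t₁ → lam t = 0 := fun t ht =>
    Real.smoothTransition.zero_of_nonpos (div_nonpos_of_nonpos_of_nonneg (by linarith) (by linarith))
  have hlam₁ : ∀ t, t₂ ≤ t → lam t = 1 := fun t ht =>
    Real.smoothTransition.one_of_one_le (by rw [le_div_iff₀ (by linarith)]; linarith)
  have hI : ∀ θ x, ρ x < T → pc x ≠ 0 → ρ (J (θ, x)) = ρ x ∧ pc (J (θ, x)) = Complex.exp ((θ : ℂ) * I) * pc x :=
    fun θ x hρ hc0 => monodromyMap_hI hp Φ hΦ hΦs hΦt Θ hr hΘφ hρW hns hR hTR hTr θ x hρ hc0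
  have hI0 : ∀ x, ρ x < T → pc x ≠ 0 → J (0, x) = x :=
    fun x hρ hc0 => monodromyMap_hI0 hp Φ hΦ hΦs hΦt Θ hr hΘφ hρW hns hR hTR hTr x hρ hc0
  have hIadd : ∀ θ θ' x, ρ x < T → pc x ≠ 0 → J (θ + θ', x) = J (θ, J (θ', x)) :=
    fun θ θ' x hρ hc0 => monodromyMap_hIadd hp Φ hΦ hΦs hΦt Θ hr hΘφ hρW hns hR hTR hTr θ θ' x hρ hc0
  have hIcont : ContinuousOn J (univ ×ˢ {x | ρ x < T ∧ pc x ≠ 0}) :=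
    monodromyMap_hIcont hp Φ hΦ hΦs hΦt Θ hr hΘφ hρW hns hR hTR hTr
  have hG0 : ∀ q, G (0, q) = q := fun q => restrictIf_of_apply_eq _ _ (hg0 q.1)
  have hG2π : ∀ q, G (2 * π, q) = q := fun q => restrictIf_of_apply_eq _ _ (hg2π q.1)
  have hGO : ∀ θ q, s₁ ^ 2 < ρ q → ‖pc q‖ < δ₀ → s₁ ^ 2 < ρ (G (θ, q)) ∧ pc (G (θ, q)) = Complex.exp ((θ : ℂ) * I) * pc q :=
    fun θ q hρ hq => monodromyMap_hgO Θ hρW hR hTR hT0 g hgO hgS hδ₀ θ q hρ hq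
  have hGadd : ∀ θ θ' q, s₁ ^ 2 < ρ q → ‖pc q‖ < δ₀ → G (θ + θ', q) = G (θ, G (θ', q)) :=
    fun θ θ' q hρ hq => monodromyMap_hgadd Θ hρW hR hTR hT0 g hgadd hgS hδ₀ θ θ' q hρ hq
  have hGρ : ∀ θ q, s₁ ^ 2 < ρ q → ‖pc q‖ < δ₀ → ρ q < T → ρ (G (θ, q)) = ρ q :=
    fun θ q hρ hq hρT => monodromyMap_hgρ Θ hρW hR hTR hT0 g hgO hgS hgF hs₀₁ hTr₂ hδ₀ θ q hρ hq hρT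
  have hGcont : Continuous G := monodromyMap_hgcont g hgc hgS
  have hs₀₁' : s₁ ^ 2 ≤ t₁ := ht₁
  -- the three maps
  refine ⟨fun ux => if ρ ux.2 ≤ T' then G (2 * π * ux.1 * lam (ρ ux.2), J (2 * π * ux.1 * (1 - lam (ρ ux.2)), ux.2))
      else G (2 * π * ux.1, ux.2),
    fun ux => if ρ ux.2 ≤ T' then J (-(2 * π * ux.1 * (1 - lam (ρ ux.2))), G (-(2 * π * ux.1 * lam (ρ ux.2)), ux.2))
      else G (-(2 * π * ux.1), ux.2),
    fun sx => G (2 * π * sx.1 * lam (ρ sx.2), J (2 * π * (1 - sx.1 * lam (ρ sx.2)), sx.2)),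
    ?_, ?_, ?_, ?_, ?_, ?_⟩
  · exact continuous_shellIsotopy' hρc ht₂ hT' hlam hlam₁ hIcont hI0 hGcont
  · intro x hx0
    exact shellIsotopy_zero' (lam := lam) hT' hI0 hG0 hx0
  · intro u x hx0 hxδ
    have hρx : ρ x = satRadius p Θ R''' R'' x.1 := monodromyMap_cutRadius_eq Θ hρW hR hTR hT0 hδ₀ hxδ
    obtain ⟨hpc, hρ₁, hρ₂⟩ := apply_shellIsotopy' hs₀₁' ht₁₂ ht₂ hT' hlam₀ hI hG0 hGO hGadd hGρ u hxδ hx0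
    have hnorm : ‖pc (if ρ x ≤ T' then G (2 * π * u * lam (ρ x), J (2 * π * u * (1 - lam (ρ x)), x))
        else G (2 * π * u, x))‖ < δ₀ := by
      rw [hpc, norm_mul, Complex.norm_exp_ofReal_mul_I, one_mul]; exact hxδ
    have hρh := monodromyMap_cutRadius_eq Θ hρW hR hTR hT0 hδ₀ hnorm
    refine ⟨hpc, fun hF => ?_, fun hF => ?_, ?_, ?_⟩
    · have h := hρ₁ (by rw [hρx]; exact hF)
      exact hρh.symm.trans (h.trans hρx)
    · have h := hρ₂ (by rw [hρx]; exact hF)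
      exact lt_of_lt_of_eq h hρh
    · exact shellIsotopy_leftInverse' hs₀₁' ht₁₂ ht₂ hT' hlam₀ hI hI0 hIadd hG0 hGO hGadd hGρ u hxδ hx0
    · exact shellIsotopy_rightInverse' hs₀₁' ht₁₂ ht₂ hT' hlam₀ hI hI0 hIadd hG0 hGO hGadd hGρ u hxδ hx0
  · intro x hx0 hxδ hF
    have hρx : ρ x = satRadius p Θ R''' R'' x.1 := monodromyMap_cutRadius_eq Θ hρW hR hTR hT0 hδ₀ hxδ
    exact shellIsotopy_one_of_ge' hT' hlam₁ hI0 hG2π (by rw [hρx]; exact hF) hx0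
  · refine (continuousOn_shellHomotopy' hρc hlam hIcont hGcont).mono (prod_mono le_rfl ?_)
    rintro x ⟨hF, hx0, hxδ⟩
    have hρx : ρ x = satRadius p Θ R''' R'' x.1 := monodromyMap_cutRadius_eq Θ hρW hR hTR hT0 hδ₀ hxδ
    exact ⟨by rw [hρx]; exact hF, hx0⟩
  · intro s x hx0 hxδ hF
    have hρx : ρ x = satRadius p Θ R''' R'' x.1 := monodromyMap_cutRadius_eq Θ hρW hR hTR hT0 hδ₀ hxδ
    have hρT : ρ x < T := by rw [hρx]; exact hF
    obtain ⟨hpc, hρH, hH0, hH1⟩ := apply_shellHomotopy' hs₀₁' hlam₀ hI hG0 hGO hGρ s hxδ hx0 hρT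
    have hnorm : ‖pc (G (2 * π * s * lam (ρ x), J (2 * π * (1 - s * lam (ρ x)), x)))‖ < δ₀ := by rw [hpc]; exact hxδ
    have hρh := monodromyMap_cutRadius_eq Θ hρW hR hTR hT0 hδ₀ hnorm
    refine ⟨hpc, hρh.symm.trans (hρH.trans hρx), ?_, fun hF' => hH1 (by rw [hρx]; exact hF')⟩
    change (G (2 * π * (0 : ℝ) * lam (ρ x), J (2 * π * (1 - (0 : ℝ) * lam (ρ x)), x))).1 = _
    rw [hH0]
    obtain ⟨hF', hcρ⟩ := monodromyMap_good_of_cutRadius_lt Θ hρW hρT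
    exact monodromyMap_model_coe hp Φ hΦ hΦs hΦt Θ hr hΘφ hns hR hTR hTr hF' hx0 hcρ (2 * π)

end MonodromyMap

end Literature.AlgebraicGeometry.HodgeTheory

end
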